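import Summits.BirchSwinnertonDyer.Rank1Residual.X11b.LocalTorsionTamagawa
import Summits.BirchSwinnertonDyer.Rank1Residual.X2.TwistParityStability
import Summits.BirchSwinnertonDyer.Rank1Residual.X2.ClassClosureO9
import Summits.BirchSwinnertonDyer.Rank1Residual.X2.ParitySqueezeForms
import Summits.BirchSwinnertonDyer.Rank1Residual.X2.RankOneParitySqueeze
import Summits.BirchSwinnertonDyer.Rank1Residual.Partition.Corners
import HarnessLib

/-!
# Class X2 (odd multiplicative Eisenstein prime): rational `p`-torsion forces SPLIT reduction at `p`
# and `p ∣ c_p`; at a NON-SPLIT `p` there is no rational `p`-torsion (cell `b2b-bsdres`, unit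
# `b2b-bsdres-lit-cgls`, session 10 — elementary reductions of the reducible column, 0 facts)

HONEST FRAMING (run/shared/lean/b2b/bsd-rank1-residual/, verbatim in every file): the goal of the
cell is to DELETE the COMBINATION-SHAPED residual classes of the Birch–Swinnerton-Dyer formula for
ALL analytic-rank `≤ 1` elliptic curves over `ℚ` — "full BSD formula for every rank `≤ 1` curve in
class `C`" assembled STRICTLY from published theorems — so that the rank-`≤ 1` remainder becomes
exactly the CONSTRUCTION-SHAPED classes, which are TYPED (missing-input `Prop`s), NOT attempted.
This is not "finishing BSD". Research routes; NO CLAIM BEYOND STATED CLASSES; nothing here changes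
a label; X2b / X2c stay CONSTRUCTION-SHAPED. THEOREMS ONLY (no definition, no named fact, no
`sorry`); nothing about any particular curve is asserted.

## What this file kernel-checks, and why

The CLASS-CLOSURE sub-partitions of the multiplicative Eisenstein classes O9 (= X2c = `X2.CellC`,
`r_an = 1`, 12 665 cells) and N9 (X2 ∩ {`r_an = 0`}, 186 cells) — instrument `obsanat`,
`class-closure/{O9,N9}/SUBPARTITION.md`, EVIDENCE only — carry the bits split / non-split at `p`,
`p ∣ c_p`, `p ∣ #E(ℚ)_tors`. Two combinations never occur there ("non-split ∧ `p ∣ #T`": 0 of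
3 163 + 84 non-split cells; "`p ∣ #T` ∧ `p ∤ c_p`": 0 of 6 975 + 75 cells with `p ∣ #T`), and this
file proves they CANNOT occur, for every elliptic curve over `ℚ` and every multiplicative `p ≥ 3`:

  **`p ∣ #E(ℚ)_tors ⟹` SPLIT multiplicative reduction at `p`, `p ∣ v_p(Δ_min) = c_p`, `p ∣ ∏_ℓ c_ℓ`;
  equivalently NON-SPLIT multiplicative `p ≥ 3 ⟹ E(ℚ)[p] = 0`.**

The GLOBAL corollary of the x11b/multr1 lineage's LOCAL theorems
`X11b.LocalTorsion.localTorsion_eq_zero_of_mult` / `split_and_dvd_of_localTorsion_ne_zero`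
(`E(ℚ_p)[p] = 0` at a multiplicative `p ≥ 3` unless split with `p ∣ v_p(Δ_min)`; *AEC* VII.2.1,
VII.3.1, VII.6.1 = Kodaira–Néron, proved in the tree), composed with `E(ℚ) ↪ E(ℚ_p)` (Mathlib
`Point.map_injective`, tree `WeierstrassCurve.toPadicPoint`) and Cauchy in `E(ℚ)_tors`
(`exists_addOrderOf_eq_of_dvd_torsionOrder`). The multiplicative twin of the good-prime reduction
`Rank1Residual.anom_of_dvd_torsionOrder` (rational `p`-torsion at good `p ≥ 3 ⟹ a_p ≡ 1`; here
⟹ `a_p = +1`).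

* §1 `split_and_dvd_of_dvd_torsionOrder_of_mult` (+ point-of-order-`p` form, four projections);
  `not_dvd_torsionOrder_of_not_split_of_mult`, `padicValNat_torsionOrder_eq_zero_of_not_split_of_mult`,
  `eq_zero_of_nsmul_eq_zero_of_not_split_of_mult` (`E(ℚ)[p] = 0`), also from `p ∤ ∏ c_ℓ` /
  `p ∤ v_p(Δ_min)`; isogeny-class forms: rational `p`-torsion ANYWHERE in the `ℚ`-isogeny class
  forces split reduction for EVERY member (`IsogenyQuotientLine.hasSplitMultiplicativeReductionAtPrime_iff_of_isIsogenous`).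
* §2 Consumers — the torsion binder of eisenstein-p2's route P is AUTOMATIC at a non-split prime:
  `mazurMainConjectureAt_of_lamTwo_of_nonsplit_of_dvd_tamagawaProduct` (`r_an = 0`: `μ_an = 0 ∧
  λ_an = 2 ∧ p ∣ ∏ c_ℓ ⟹` Mazur's MC at the pair; was `2·ord_p #T < ord_p ∏ c`),
  `bsdp_of_lamTwo_of_nonsplit_of_dvd_tamagawaProduct`, `mazurMainConjectureAt_of_routeP_rankOne_nonsplit`
  (`r_an = 1`, binder `htors` dropped).
* §3 Readings for the O9 / N9 sub-partitions (cc-typer-6's predicates, `X2/ClassClosureO9.lean`):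
  **`cellCSplitNotGV_of_cellC_of_dvd_torsionOrder`** — an O9 cell with `p ∣ #E(ℚ)_tors` lies in
  `CellCSplitNotGV` (split by §1; ψ even by session 9's `not_gvPar_of_dvd_torsionOrder_of_mult`,
  granted the Tate-uniformisation facts `hT`, `hT'`): the sub-cell with NO main-conjecture transport in
  print or per pair (route G is non-split only) and NO printed rank-one leading term — **the
  rational-`p`-torsion part of O9 (6 975 / 12 665 cells = 55.1 %) sits in the hardest corner BY
  THEOREM**, as obsanat records (all 6 975 split, `p ∣ c_p`); `not_cellCNonsplit{GV,NotGV}_…` (no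
  `hT`), `not_cellCSplitGV_…`, the isogeny-class form; N9: `cellB_and_split_of_mult_of_dvd_torsionOrder`
  (75 / 186 cells). Not attempted: `E(ℚ_p)[p]` on the split cells with `p ∣ v_p(Δ_min)`, `p ∤ #T`
  (2 527 O9 cells; a per-pair datum, cf. `LocalTorsionMultiplicative.lean`). For the
  verbatim-extension (α) of CGLS-GV-TYPING §14.3 (anticyclotomic CONTROL under `E(K)[p] = 0` at
  `p ‖ N`): its torsion hypothesis FAILS on every `p ∣ #T` cell for every `K ⊇ ℚ` and HOLDS at
  `K_v = ℚ_p` on every non-split cell (`localTorsion_eq_zero_of_nonsplit`).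

References: [SilvermanAEC2009] VII.2.1, VII.3.1, VII.3.4, VII.6.1, Ex. 7.5; [SilvermanATAEC1994] Cor.
IV.9.2; [GreenbergVatsal2000] Thm. (1.3), §2 p. 28; [GreenbergLNM1716] Prop. 3.10; [Wuthrich2014] Thm. 16;
[SteinWuthrich2013] Thm. 6.1; HOME/class-closure/{O9,N9}/SUBPARTITION.md; CGLS-GV-TYPING.md §17.
-/

set_option autoImplicit false

noncomputable section

open scoped Classical MatrixGroups ModularForm

open PowerSeries CongruenceSubgroup WeierstrassCurve Literature.NumberTheory.EllipticCurves
  Literature.NumberTheory.EllipticCurves.ModularForms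
  Literature.NumberTheory.EllipticCurves.Rank1Residual
  Literature.NumberTheory.EllipticCurves.Rank1Residual.Typed
  Literature.NumberTheory.EllipticCurves.Wuthrich2014
  Literature.NumberTheory.EllipticCurves.SteinWuthrich2013
  Literature.NumberTheory.EllipticCurves.Greenberg1999

namespace Summit.BirchSwinnertonDyer.Rank1Residual.X2

/-! ## §1. Global from local: rational `p`-torsion at a multiplicative `p ≥ 3` forces split
reduction and `p ∣ c_p` -/

section GlobalFromLocal

variable (W : WeierstrassCurve ℚ) [W.IsElliptic] (p : ℕ) [hp : Fact p.Prime]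

omit [W.IsElliptic] in
/-- **A rational point of order `p` is a non-zero `p`-torsion point of `E(ℚ_p)`**: the map
`E(ℚ) → E(ℚ_p)` (tree `WeierstrassCurve.toPadicPoint` = Mathlib's `Point.map` along `ℚ → ℚ_p`) is
an injective homomorphism, so it preserves the order of a point. [cite: SilvermanAEC2009, VII.3 Prop. 3.1 (the setting: `E(K) ⊂ E(K_v)`)] -/
theorem nsmul_toPadicPoint_eq_zero_and_ne_zero_of_addOrderOf_eq {P : W.toAffine.Point}
    (hP : addOrderOf P = p) : p • W.toPadicPoint p P = 0 ∧ W.toPadicPoint p P ≠ 0 := by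
  have hord : addOrderOf (W.toPadicPoint p P) = p :=
    (addOrderOf_injective (W.toPadicPoint p)
      (Affine.Point.map_injective (W' := W.toAffine) (f := Algebra.ofId ℚ ℚ_[p])) P).trans hP
  refine ⟨?_, fun h0 ↦ ?_⟩
  · have h := addOrderOf_nsmul_eq_zero (W.toPadicPoint p P)
    rwa [hord] at h
  · rw [h0, addOrderOf_zero] at hord
    exact hp.out.one_lt.ne hord

/-- **`p ∣ #E(ℚ)_tors ⟹ E(ℚ_p)[p] ≠ 0`**: a rational point of order `p` exists (Cauchy, tree
`exists_addOrderOf_eq_of_dvd_torsionOrder`) and maps to a non-zero `p`-torsion point of `E(ℚ_p)`.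
In particular the local-torsion hypothesis "`E(ℚ_p)[p] = 0`" (Castella's erratum Thm. A′ (2);
CGLS 2022 Thm. 5.1.1) FAILS at every such pair. [cite: SilvermanAEC2009, VII.3 Prop. 3.1 and Thm. 3.4] -/
theorem exists_localTorsion_ne_zero_of_dvd_torsionOrder (htors : p ∣ W.torsionOrder) :
    ∃ Q : (W.baseChange ℚ_[p]).toAffine.Point, p • Q = 0 ∧ Q ≠ 0 := by
  obtain ⟨T, hT⟩ := exists_addOrderOf_eq_of_dvd_torsionOrder W p htors
  exact ⟨W.toPadicPoint p T, nsmul_toPadicPoint_eq_zero_and_ne_zero_of_addOrderOf_eq W p hT⟩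

variable [W.IsGloballyMinimal]

/-- **A rational point of order `p` at a multiplicative prime `p ≥ 3` forces: SPLIT reduction at `p`,
`p ∣ v_p(Δ_min)`, `p ∣ c_p`, and `p ∣ ∏_ℓ c_ℓ(E)`.** For `W/ℚ` globally minimal elliptic,
`p ≥ 3` of multiplicative reduction and `P ∈ E(ℚ)` of order `p`. The global corollary of
`X11b.LocalTorsion.split_and_dvd_of_localTorsion_ne_zero` (x11b/multr1: `E(ℚ_p)[p] = 0` at a
multiplicative `p ≥ 3` unless split with `p ∣ v_p(Δ_min)`; Kodaira–Néron `c_p = v_p(Δ_min)` in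
the split case) applied to the image of `P` in `E(ℚ_p)`. [cite: SilvermanAEC2009, VII.2 Prop. 2.1, VII.3 Prop. 3.1, Thm. VII.6.1]
[cite: SilvermanATAEC1994, Cor. IV.9.2(d) with (b) (PDF p. 340)] -/
theorem split_and_dvd_of_addOrderOf_eq_of_mult (hp3 : 3 ≤ p) (hmult : Mult W p)
    {P : W.toAffine.Point} (hP : addOrderOf P = p) :
    W.HasSplitMultiplicativeReductionAtPrime p ∧ p ∣ padicValInt p W.minimalDiscriminantInt ∧
      p ∣ (W.baseChange ℚ_[p]).localTamagawaNumber ℤ_[p] ∧ p ∣ W.tamagawaProduct := by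
  obtain ⟨hQ, hne⟩ := nsmul_toPadicPoint_eq_zero_and_ne_zero_of_addOrderOf_eq W p hP
  exact X11b.LocalTorsion.split_and_dvd_of_localTorsion_ne_zero W p hp3 hmult (W.toPadicPoint p P)
    hQ hne

/-- **`p ∣ #E(ℚ)_tors` at a multiplicative prime `p ≥ 3` forces: SPLIT reduction at `p`,
`p ∣ v_p(Δ_min)`, `p ∣ c_p`, and `p ∣ ∏_ℓ c_ℓ(E)`** (Cauchy + the previous theorem). The
multiplicative twin of `Rank1Residual.anom_of_dvd_torsionOrder` (good `p`: rational `p`-torsion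
⟹ `a_p ≡ 1 (mod p)`; here ⟹ `a_p = +1`). [cite: SilvermanAEC2009, VII.3 Thm. 3.4, Thm. VII.6.1, Ex. 7.5]
[cite: SilvermanATAEC1994, Cor. IV.9.2(d) with (b) (PDF p. 340)] -/
theorem split_and_dvd_of_dvd_torsionOrder_of_mult (hp3 : 3 ≤ p) (hmult : Mult W p)
    (htors : p ∣ W.torsionOrder) :
    W.HasSplitMultiplicativeReductionAtPrime p ∧ p ∣ padicValInt p W.minimalDiscriminantInt ∧
      p ∣ (W.baseChange ℚ_[p]).localTamagawaNumber ℤ_[p] ∧ p ∣ W.tamagawaProduct := by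
  obtain ⟨T, hT⟩ := exists_addOrderOf_eq_of_dvd_torsionOrder W p htors
  exact split_and_dvd_of_addOrderOf_eq_of_mult W p hp3 hmult hT

/-- **`p ∣ #E(ℚ)_tors` at a multiplicative `p ≥ 3 ⟹` SPLIT multiplicative reduction at `p`.**
[cite: SilvermanAEC2009, Thm. VII.6.1 and Ex. 7.5] -/
theorem hasSplitMultiplicativeReductionAtPrime_of_dvd_torsionOrder (hp3 : 3 ≤ p) (hmult : Mult W p)
    (htors : p ∣ W.torsionOrder) : W.HasSplitMultiplicativeReductionAtPrime p :=
  (split_and_dvd_of_dvd_torsionOrder_of_mult W p hp3 hmult htors).1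

/-- **`p ∣ #E(ℚ)_tors` at a multiplicative `p ≥ 3 ⟹ p ∣ v_p(Δ_min)`** (`= −v_p(j)`).
[cite: SilvermanAEC2009, Thm. VII.6.1 and Ex. 7.5] -/
theorem dvd_padicValInt_minimalDiscriminant_of_dvd_torsionOrder_of_mult (hp3 : 3 ≤ p)
    (hmult : Mult W p) (htors : p ∣ W.torsionOrder) :
    p ∣ padicValInt p W.minimalDiscriminantInt :=
  (split_and_dvd_of_dvd_torsionOrder_of_mult W p hp3 hmult htors).2.1

/-- **`p ∣ #E(ℚ)_tors` at a multiplicative `p ≥ 3 ⟹ p ∣ c_p(E)`** (the local Tamagawa number at `p`).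
[cite: SilvermanATAEC1994, Cor. IV.9.2(d) with (b) (PDF p. 340)] -/
theorem dvd_localTamagawaNumber_of_dvd_torsionOrder_of_mult (hp3 : 3 ≤ p) (hmult : Mult W p)
    (htors : p ∣ W.torsionOrder) : p ∣ (W.baseChange ℚ_[p]).localTamagawaNumber ℤ_[p] :=
  (split_and_dvd_of_dvd_torsionOrder_of_mult W p hp3 hmult htors).2.2.1

/-- **`p ∣ #E(ℚ)_tors` at a multiplicative `p ≥ 3 ⟹ p ∣ ∏_ℓ c_ℓ(E)`** (the Tamagawa atom holds).
[cite: SilvermanATAEC1994, Cor. IV.9.2(d) with (b) (PDF p. 340)] -/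
theorem dvd_tamagawaProduct_of_dvd_torsionOrder_of_mult (hp3 : 3 ≤ p) (hmult : Mult W p)
    (htors : p ∣ W.torsionOrder) : p ∣ W.tamagawaProduct :=
  (split_and_dvd_of_dvd_torsionOrder_of_mult W p hp3 hmult htors).2.2.2

/-- **NON-SPLIT multiplicative `p ≥ 3 ⟹ p ∤ #E(ℚ)_tors`.** [cite: SilvermanAEC2009, Thm. VII.6.1 and Ex. 7.5] -/
theorem not_dvd_torsionOrder_of_not_split_of_mult (hp3 : 3 ≤ p) (hmult : Mult W p)
    (hns : ¬ W.HasSplitMultiplicativeReductionAtPrime p) : ¬ p ∣ W.torsionOrder := fun h ↦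
  hns (hasSplitMultiplicativeReductionAtPrime_of_dvd_torsionOrder W p hp3 hmult h)

/-- Non-split multiplicative `p ≥ 3 ⟹ ord_p #E(ℚ)_tors = 0` (the summand of route P's inequalities).
[cite: SilvermanAEC2009, Thm. VII.6.1 and Ex. 7.5] -/
theorem padicValNat_torsionOrder_eq_zero_of_not_split_of_mult (hp3 : 3 ≤ p) (hmult : Mult W p)
    (hns : ¬ W.HasSplitMultiplicativeReductionAtPrime p) : padicValNat p W.torsionOrder = 0 :=
  padicValNat.eq_zero_of_not_dvd (not_dvd_torsionOrder_of_not_split_of_mult W p hp3 hmult hns)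

/-- Multiplicative `p ≥ 3` with `p ∤ ∏_ℓ c_ℓ(E) ⟹ p ∤ #E(ℚ)_tors` (off the Tamagawa atom there is
no rational `p`-torsion). [cite: SilvermanATAEC1994, Cor. IV.9.2(d) with (b) (PDF p. 340)] -/
theorem not_dvd_torsionOrder_of_not_dvd_tamagawaProduct_of_mult (hp3 : 3 ≤ p) (hmult : Mult W p)
    (htam : ¬ p ∣ W.tamagawaProduct) : ¬ p ∣ W.torsionOrder := fun h ↦
  htam (dvd_tamagawaProduct_of_dvd_torsionOrder_of_mult W p hp3 hmult h)

/-- Multiplicative `p ≥ 3` with `p ∤ v_p(Δ_min) ⟹ p ∤ #E(ℚ)_tors`. [cite: SilvermanAEC2009, Thm. VII.6.1 and Ex. 7.5] -/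
theorem not_dvd_torsionOrder_of_not_dvd_padicValInt_of_mult (hp3 : 3 ≤ p) (hmult : Mult W p)
    (hv : ¬ p ∣ padicValInt p W.minimalDiscriminantInt) : ¬ p ∣ W.torsionOrder := fun h ↦
  hv (dvd_padicValInt_minimalDiscriminant_of_dvd_torsionOrder_of_mult W p hp3 hmult h)

/-- **`E(ℚ)[p] = 0` at a NON-SPLIT multiplicative `p ≥ 3`**: every rational `P` with `p • P = O`
is `O` (`E(ℚ_p)[p] = 0` there, `localTorsion_eq_zero_of_nonsplit`, and `E(ℚ) ↪ E(ℚ_p)`).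
[cite: SilvermanAEC2009, VII.3 Prop. 3.1, Thm. VII.6.1 and Ex. 7.5] -/
theorem eq_zero_of_nsmul_eq_zero_of_not_split_of_mult (hp3 : 3 ≤ p) (hmult : Mult W p)
    (hns : ¬ W.HasSplitMultiplicativeReductionAtPrime p) (P : W.toAffine.Point) (hP : p • P = 0) :
    P = 0 := by
  have h0 : W.toPadicPoint p P = 0 :=
    X11b.LocalTorsion.localTorsion_eq_zero_of_nonsplit W p hp3 hmult hns (W.toPadicPoint p P)
      (by rw [← map_nsmul, hP, map_zero])
  exact (injective_iff_map_eq_zero (W.toPadicPoint p)).mp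
    (Affine.Point.map_injective (W' := W.toAffine) (f := Algebra.ofId ℚ ℚ_[p])) P h0

/-! ### Isogeny-class forms: rational `p`-torsion anywhere in the class forces split reduction -/

variable {W} {W' : WeierstrassCurve ℚ} [W'.IsElliptic] [W'.IsGloballyMinimal]

omit [W.IsGloballyMinimal] in
/-- **Rational `p`-torsion ANYWHERE in the `ℚ`-isogeny class forces SPLIT reduction at a
multiplicative `p ≥ 3` for EVERY member**: `W'` is multiplicative at `p` too
(`IsogenyQuotientLine.hasMultiplicativeReductionAtPrime_of_isIsogenous`), split by
`hasSplitMultiplicativeReductionAtPrime_of_dvd_torsionOrder`, and split/non-split is an isogeny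
invariant (`IsogenyQuotientLine.hasSplitMultiplicativeReductionAtPrime_iff_of_isIsogenous`, equal
`L`-functions). [cite: SilvermanAEC2009, Thm. VII.6.1, Ex. 7.5 and §C.16] -/
theorem hasSplitMultiplicativeReductionAtPrime_of_isIsogenous_of_dvd_torsionOrder (hp3 : 3 ≤ p)
    (hmult : Mult W p) (h : IsIsogenous W W') (htors : p ∣ W'.torsionOrder) :
    W.HasSplitMultiplicativeReductionAtPrime p :=
  (IsogenyQuotientLine.hasSplitMultiplicativeReductionAtPrime_iff_of_isIsogenous h).mpr
    (hasSplitMultiplicativeReductionAtPrime_of_dvd_torsionOrder W' p hp3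
      (IsogenyQuotientLine.hasMultiplicativeReductionAtPrime_of_isIsogenous h hmult) htors)

omit [W.IsGloballyMinimal] in
/-- **At a NON-SPLIT multiplicative `p ≥ 3` NO curve of the `ℚ`-isogeny class has rational
`p`-torsion.** [cite: SilvermanAEC2009, Thm. VII.6.1, Ex. 7.5 and §C.16] -/
theorem not_dvd_torsionOrder_of_isIsogenous_of_not_split_of_mult (hp3 : 3 ≤ p) (hmult : Mult W p)
    (hns : ¬ W.HasSplitMultiplicativeReductionAtPrime p) (h : IsIsogenous W W') :
    ¬ p ∣ W'.torsionOrder := fun htors ↦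
  hns (hasSplitMultiplicativeReductionAtPrime_of_isIsogenous_of_dvd_torsionOrder p hp3 hmult h htors)

end GlobalFromLocal

/-! ## §2. Consumers: the torsion binder of route P is automatic at a non-split prime -/

section RouteP

variable {W : WeierstrassCurve ℚ} [W.IsElliptic] [W.IsGloballyMinimal] {p : ℕ} [Fact p.Prime]

/-- **Route P at a NON-SPLIT multiplicative Eisenstein prime, rank `0`, torsion summand REMOVED:
`μ_an = 0 ∧ λ_an = 2 ∧ p ∣ ∏_ℓ c_ℓ ⟹` Mazur's main conjecture at `(E,p)`** (the inequality
`2·ord_p #E(ℚ)_tors < ord_p ∏_ℓ c_ℓ` of eisenstein-p2's `mazurMainConjectureAt_of_lamTwo_of_nonsplit`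
reads `0 < ord_p ∏_ℓ c_ℓ`, since `ord_p #E(ℚ)_tors = 0` at a non-split `p ≥ 3`, §1).
[cite: GreenbergLNM1716, Prop. 3.10 and §5 p. 183] [cite: Wuthrich2014, Thm. 16 (p. 397)] [cite: SilvermanAEC2009, Thm. VII.6.1, Ex. 7.5] -/
theorem mazurMainConjectureAt_of_lamTwo_of_nonsplit_of_dvd_tamagawaProduct
    (hWu : thm16_charIdeal_dvd_multiplicative_of_reducible)
    (hJs : thm61_splitMultiplicative) (hJn : thm61_nonsplitMultiplicative)
    (hHs : exists_isSplitMultCanonical) (hHn : exists_isMultCanonical)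
    (h310 : prop310_selmerCorank_mod_two_eq_lambdaInvariant)
    (hGZK : rank_eq_analyticRank_of_analyticRank_le_one) (hmod : hasEntireLFunction_rat)
    (W : WeierstrassCurve ℚ) [W.IsElliptic] [W.IsGloballyMinimal] (p : ℕ) [Fact p.Prime]
    (hGS : greenberg_stevens (W := W) (p := p))
    (hp2 : p ≠ 2) (hmult : W.HasMultiplicativeReductionAtPrime p)
    (hns : ¬ W.HasSplitMultiplicativeReductionAtPrime p)
    (hred : ¬ W.HasIrreducibleModPGaloisRep p) (hr : W.analyticRank = 0)
    (hμ0 : AnalyticMuLE W p 0) (hlam2 : AnalyticLambdaEq W p 2)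
    (htam : p ∣ W.tamagawaProduct) : X2.MazurMainConjectureAt W p := by
  refine mazurMainConjectureAt_of_lamTwo_of_nonsplit hWu hJs hJn hHs hHn h310 hGZK hmod W p hGS hp2
    hmult hns hred hr hμ0 hlam2 ?_
  rw [padicValNat_torsionOrder_eq_zero_of_not_split_of_mult W p (three_le_of_ne_two hp2) hmult hns,
    mul_zero]
  exact Nat.pos_of_ne_zero fun h0 ↦ by
    rw [padicValNat.eq_zero_iff] at h0
    rcases h0 with h1 | h1 | h1
    · exact (Fact.out : p.Prime).one_lt.ne' h1
    · exact (W.tamagawaProduct_pos').ne' h1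
    · exact h1 htam

/-- **Route P ⟹ `BSD(E,p)` at a NON-SPLIT multiplicative Eisenstein prime, rank `0`, binder
`p ∤ #E(ℚ)_tors` DROPPED** (a theorem at a non-split `p ≥ 3`, §1): `p ∣ ∏ c_ℓ ∧ μ_an = 0 ∧ λ_an = 2
⟹ BSD(E,p)`, from eisenstein-p2's `bsdp_of_lamTwo_of_nonsplit_of_not_dvd_torsionOrder`.
[cite: GreenbergLNM1716, Prop. 3.10 and §5 p. 183] [cite: Wuthrich2014, Thm. 16 (p. 397)] [cite: SilvermanAEC2009, Thm. VII.6.1, Ex. 7.5] -/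
theorem bsdp_of_lamTwo_of_nonsplit_of_dvd_tamagawaProduct
    (hWu : thm16_charIdeal_dvd_multiplicative_of_reducible)
    (hJs : thm61_splitMultiplicative) (hJn : thm61_nonsplitMultiplicative)
    (hHs : exists_isSplitMultCanonical) (hHn : exists_isMultCanonical)
    (h310 : prop310_selmerCorank_mod_two_eq_lambdaInvariant)
    (hGZK : rank_eq_analyticRank_of_analyticRank_le_one) (hmod : hasEntireLFunction_rat)
    (hpar : nonempty_modularParametrizationData)
    (W : WeierstrassCurve ℚ) [W.IsElliptic] [W.IsGloballyMinimal] (p : ℕ) [Fact p.Prime]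
    (hGS : greenberg_stevens (W := W) (p := p))
    (hp2 : p ≠ 2) (hmult : W.HasMultiplicativeReductionAtPrime p)
    (hns : ¬ W.HasSplitMultiplicativeReductionAtPrime p)
    (hred : ¬ W.HasIrreducibleModPGaloisRep p) (hr : W.analyticRank = 0)
    (htam : p ∣ W.tamagawaProduct)
    (hμ0 : AnalyticMuLE W p 0) (hlam2 : AnalyticLambdaEq W p 2) : BSDp W p :=
  bsdp_of_lamTwo_of_nonsplit_of_not_dvd_torsionOrder hWu hJs hJn hHs hHn h310 hGZK hmod hpar W p hGS
    hp2 hmult hns hred hr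
    (not_dvd_torsionOrder_of_not_split_of_mult W p (three_le_of_ne_two hp2) hmult hns) htam hμ0 hlam2

/-- **Route P at a NON-SPLIT multiplicative Eisenstein prime, rank `1`, binder `p ∤ #E(ℚ)_tors`
DROPPED**: `μ_an = 0 ∧ λ_an = 3 ∧ (v ≤ ord_p Reg_p for every admissible height datum) ∧
2 ≤ v + ord_p ∏ c_ℓ ⟹` Mazur's MC at the pair (`BSD(E,p)` NOT claimed — lever L3); from eisenstein-p2's
`mazurMainConjectureAt_of_routeP_rankOne_nonsplit_of_not_dvd_torsionOrder`.
[cite: GreenbergLNM1716, Prop. 3.10 and §5 p. 183] [cite: SteinWuthrich2013, Thm. 6.1 (p. 20)] [cite: SilvermanAEC2009, Thm. VII.6.1, Ex. 7.5] -/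
theorem mazurMainConjectureAt_of_routeP_rankOne_nonsplit
    (hWu : thm16_charIdeal_dvd_multiplicative_of_reducible)
    (hJs : thm61_splitMultiplicative) (hJn : thm61_nonsplitMultiplicative)
    (hHs : exists_isSplitMultCanonical) (hHn : exists_isMultCanonical)
    (h310 : prop310_selmerCorank_mod_two_eq_lambdaInvariant)
    (hGZK : rank_eq_analyticRank_of_analyticRank_le_one)
    (W : WeierstrassCurve ℚ) [W.IsElliptic] [W.IsGloballyMinimal] (p : ℕ) [Fact p.Prime]
    (hp2 : p ≠ 2) (hmult : W.HasMultiplicativeReductionAtPrime p)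
    (hns : ¬ W.HasSplitMultiplicativeReductionAtPrime p)
    (hred : ¬ W.HasIrreducibleModPGaloisRep p) (hr : W.analyticRank = 1)
    (hμ0 : AnalyticMuLE W p 0) (hlam3 : AnalyticLambdaEq W p 3) {v : ℤ}
    (hv : ∀ (q : ℚ_[p]) (Dh : PAdicHeightData W p), q ≠ 0 → ‖q‖ < 1 → tateJ q = (W.j : ℚ_[p]) →
      IsMultCanonical Dh q → padicRegulator Dh ≠ 0 → v ≤ (padicRegulator Dh).valuation)
    (hb : 2 ≤ v + padicValNat p W.tamagawaProduct) :
    X2.MazurMainConjectureAt W p :=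
  mazurMainConjectureAt_of_routeP_rankOne_nonsplit_of_not_dvd_torsionOrder hWu hJs hJn hHs hHn h310
    hGZK W p hp2 hmult hns hred hr hμ0 hlam3
    (not_dvd_torsionOrder_of_not_split_of_mult W p (three_le_of_ne_two hp2) hmult hns) hv hb

end RouteP

/-! ## §3. Readings for the O9 / N9 sub-partitions: rational `p`-torsion puts the cell in the
split, ψ-even corner -/

section SubPartition

variable {W : WeierstrassCurve ℚ} [W.IsElliptic] [W.IsGloballyMinimal] {p : ℕ} [Fact p.Prime]

/-- **An O9 cell with `p ∣ #E(ℚ)_tors` lies in the sub-cell `CellCSplitNotGV` (split, ψ even).**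
`CellC W p` (`r_an = 1 ∧ X2`) and `p ∣ #E(ℚ)_tors` give split reduction at `p` (§1, `p ≥ 3` from
X2's `p ≠ 2`) and `¬ GVPar W p` (session 9's `not_gvPar_of_dvd_torsionOrder_of_mult`, granted the
Tate-uniformisation facts `hT`, `hT'`). This is the sub-cell with no main-conjecture transport in
print or per pair and no printed rank-one leading term (`ClassClosureO9.lean` table, last row):
the rational-`p`-torsion part of O9 sits there BY THEOREM. [cite: SilvermanAEC2009, Thm. VII.6.1 and Ex. 7.5]
[cite: GreenbergVatsal2000, Thm. (1.3) and §2 p. 28] [cite: SilvermanATAEC1994, Thm. V.5.3 and Cor. V.5.4] -/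
theorem cellCSplitNotGV_of_cellC_of_dvd_torsionOrder
    (hT : Silverman1994_thmV53_tateUniformisation.{0})
    (hT' : Silverman1994_thmV53_corV54_tateUniformisation.{0})
    (hc : CellC W p) (htors : p ∣ W.torsionOrder) : CellCSplitNotGV W p :=
  ⟨hc, hasSplitMultiplicativeReductionAtPrime_of_dvd_torsionOrder W p (three_le_of_ne_two hc.2.1)
    hc.2.2.2 htors, not_gvPar_of_dvd_torsionOrder_of_mult W hT hT' hc.2.1 hc.2.2.2 htors⟩

/-- `p ∣ #E(ℚ)_tors ⟹` NOT the sub-cell `CellCNonsplitGV` (no Tate-uniformisation input needed: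
the split bit alone). [cite: SilvermanAEC2009, Thm. VII.6.1 and Ex. 7.5] -/
theorem not_cellCNonsplitGV_of_dvd_torsionOrder (htors : p ∣ W.torsionOrder) :
    ¬ CellCNonsplitGV W p := fun h ↦
  h.2.1 (hasSplitMultiplicativeReductionAtPrime_of_dvd_torsionOrder W p (three_le_of_ne_two h.1.2.1)
    h.1.2.2.2 htors)

/-- `p ∣ #E(ℚ)_tors ⟹` NOT the sub-cell `CellCNonsplitNotGV` (route G's non-split cell).
[cite: SilvermanAEC2009, Thm. VII.6.1 and Ex. 7.5] -/
theorem not_cellCNonsplitNotGV_of_dvd_torsionOrder (htors : p ∣ W.torsionOrder) :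
    ¬ CellCNonsplitNotGV W p := fun h ↦
  h.2.1 (hasSplitMultiplicativeReductionAtPrime_of_dvd_torsionOrder W p (three_le_of_ne_two h.1.2.1)
    h.1.2.2.2 htors)

/-- `p ∣ #E(ℚ)_tors ⟹` NOT the sub-cell `CellCSplitGV` (the parity bit; granted `hT`, `hT'`).
[cite: GreenbergVatsal2000, Thm. (1.3) and §2 p. 28] [cite: SilvermanATAEC1994, Thm. V.5.3 and Cor. V.5.4] -/
theorem not_cellCSplitGV_of_dvd_torsionOrder
    (hT : Silverman1994_thmV53_tateUniformisation.{0})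
    (hT' : Silverman1994_thmV53_corV54_tateUniformisation.{0})
    (htors : p ∣ W.torsionOrder) : ¬ CellCSplitGV W p := fun h ↦
  not_gvPar_of_dvd_torsionOrder_of_mult W hT hT' h.1.2.1 h.1.2.2.2 htors h.2.2

/-- **N9 (X2 ∩ {`r_an = 0`}): `p ∣ #E(ℚ)_tors ⟹` sub-cell X2b AND split reduction at `p`** (odd
multiplicative `p`; granted `hT`, `hT'`): session 9's `cellB_of_mult_of_dvd_torsionOrder` plus §1.
[cite: SilvermanAEC2009, Thm. VII.6.1 and Ex. 7.5] [cite: GreenbergVatsal2000, Thm. (1.3) and §2 p. 28] -/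
theorem cellB_and_split_of_mult_of_dvd_torsionOrder
    (hT : Silverman1994_thmV53_tateUniformisation.{0})
    (hT' : Silverman1994_thmV53_corV54_tateUniformisation.{0})
    (hp2 : p ≠ 2) (hmult : W.HasMultiplicativeReductionAtPrime p) (htors : p ∣ W.torsionOrder)
    (hr0 : W.analyticRank = 0) : CellB W p ∧ W.HasSplitMultiplicativeReductionAtPrime p :=
  ⟨cellB_of_mult_of_dvd_torsionOrder W p hT hT' hp2 hmult htors hr0,
    hasSplitMultiplicativeReductionAtPrime_of_dvd_torsionOrder W p (three_le_of_ne_two hp2) hmult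
      htors⟩

variable {W' : WeierstrassCurve ℚ} [W'.IsElliptic] [W'.IsGloballyMinimal]

/-- **Isogeny-class form: an O9 cell whose `ℚ`-isogeny class contains a curve with rational
`p`-torsion lies in `CellCSplitNotGV`** (the E2 tables' column "`p ∣ #E'(ℚ)_tors` for some `E'` in
the class"; granted `hT`, `hT'`): split by `hasSplitMultiplicativeReductionAtPrime_of_isIsogenous_of_dvd_torsionOrder`,
type A by session 9's `not_gvPar_of_isIsogenous_of_dvd_torsionOrder_of_mult`.
[cite: SilvermanAEC2009, Thm. VII.6.1, Ex. 7.5 and §C.16] [cite: GreenbergVatsal2000, Thm. (1.3) and §2 p. 28] -/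
theorem cellCSplitNotGV_of_cellC_of_isIsogenous_of_dvd_torsionOrder
    (hT : Silverman1994_thmV53_tateUniformisation.{0})
    (hT' : Silverman1994_thmV53_corV54_tateUniformisation.{0})
    (hc : CellC W p) (h : IsIsogenous W W') (htors : p ∣ W'.torsionOrder) : CellCSplitNotGV W p :=
  ⟨hc, hasSplitMultiplicativeReductionAtPrime_of_isIsogenous_of_dvd_torsionOrder p
    (three_le_of_ne_two hc.2.1) hc.2.2.2 h htors,
    not_gvPar_of_isIsogenous_of_dvd_torsionOrder_of_mult hT hT' hc.2.1 hc.2.2.2 h htors⟩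

end SubPartition

end Summit.BirchSwinnertonDyer.Rank1Residual.X2

end
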